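import Literature.AlgebraicGeometry.Deformation.PairLiftTwistedCocycleObstruction
import Literature.AlgebraicGeometry.Deformation.SmoothAffineDeformationsPrincipalRestriction
import Mathlib.LinearAlgebra.TensorProduct.RightExactness
import HarnessLib

/-!
# Reduction modulo `J` of lifted transition units: lifts of an EXACT twisted unit cocycle over `A'⧸J` have twisted defect
# `≡ 1 (mod J)` (Hartshorne, *Deformation Theory*, Thm. 6.4 (a) proof: «the `𝓛'|_{U_i}` glue modulo `J`»)

Layer `Literature/AlgebraicGeometry/Deformation` (cell `hodgecm-mathlib`, F-11 sub-line `F11SmoothRoadA`, α1 grandchild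
`F11LiftWithLineBundle`, stub G2, junction (iii) of RULING (R30); THEOREMS ONLY — no definition, no instance, no notation, no named
fact).  The currency is that of ★ `Deformation/PairLiftTwistedCocycleObstruction`: the closed fibre `X/Spec k` with its `k`-structures
`halg`, a commutative `k`-algebra `A'`, a principal affine cover `U j`, `U j ∩ U l = D(b j l)`, lifted transition automorphisms `ψ j l`
of `A' ⊗_k Γ(U j ∩ U l)`; base changes `Φ` and restrictions `τ` of `(ψ j l)⁻¹` are CHARACTERISED by equations and quantified over.

NEW: a surjective `k`-algebra map `θ : A' → A''` (e.g. `A' → A'⧸J`, or an augmentation `A' → k`), gluing data `φ j l` over `A''`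
COMPATIBLE with `ψ` (`(θ ⊗ 1) ∘ ψ j l = φ j l ∘ (θ ⊗ 1)`, the binder `hψσ` of ★ `…CriterionGlueReduction`), units
`G₀ j l ∈ A'' ⊗_k Γ(U j ∩ U l)` satisfying the EXACT twisted cocycle identity w.r.t. `φ` (the output shape of
`…CriterionGlueLineBundleConverse.exists_twistedCocycle_of_frames`), and `G j l ∈ A' ⊗_k Γ(U j ∩ U l)` with `(θ ⊗ 1) (G j l) = G₀ j l`.

* §0 `mem_smul_top_iff_map_eq_zero` — `x ∈ (ker θ)·(A' ⊗ B)` iff `(θ ⊗ 1) x = 0` (right exactness of `⊗`, Mathlib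
  `Algebra.TensorProduct.rTensor_ker`); `map_baseChangeMap` — `(θ ⊗ 1) ∘ Φ = Φ₀ ∘ (θ ⊗ 1)` for characterised base changes.
* §1 **`map_restrict_symm`** — DESCENT OF THE RESTRICTION: for `τ` (over `A'`, `τ (Φ (ψ x)) = Φ x`) and `τ₀` (over `A''`,
  `τ₀ (Φ₀ (φ y)) = Φ₀ y`): `(θ ⊗ 1) (τ z) = τ₀ ((θ ⊗ 1) z)` for ALL `z` (ring maps out of the localisation `A' ⊗_k Γ(U j ∩ U l ∩ U m)`
  are determined on `A' ⊗_k Γ(U j ∩ U l)`, ★ `SmoothAffineDeformation.ringHom_ext_baseChange_away`).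
* §2 **`twistedDefect_sub_one_mem_of_map_eq`** — THE HEAD: the `G j l` satisfy the hypothesis `hGcoc` of ★
  `PairLiftTwistedCocycleObstruction.exists_pairObstructionCochain` VERBATIM: every `σ` with
  `Φjm (G j m) · σ = Φjl (G j l) · τjl (Φlm (G l m))` is `≡ 1 (mod ker θ)`.
* §3 `exists_map_eq` — lifts `G` of `G₀` exist (`θ ⊗ 1` is surjective).

HC_CM is proved only modulo the 7 printed citations until rung 0 closes — nothing here bears on a summit statement.

## References
* [Hartshorne2010] R. Hartshorne, *Deformation Theory*, GTM 257 (2010): Thm. 6.4 (a) and proof (pp. 50–51), Thm. 10.2 (a) proof (p. 81).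
* [AtiyahMacdonald1969] M. F. Atiyah, I. G. Macdonald, *Introduction to Commutative Algebra* (1969): Prop. 2.18 / Ex. 2.2
  (`(A/𝔞) ⊗ M = M/𝔞M`, right exactness of `⊗`), Prop. 3.5.
-/

noncomputable section

-- `TopCat.Presheaf`/`TopCat.Sheaf` are not reducible (as in Mathlib's `AlgebraicGeometry/Modules`).
set_option backward.isDefEq.respectTransparency false

open CategoryTheory AlgebraicGeometry Opposite TopologicalSpace
open scoped TensorProduct

universe u

namespace Literature.AlgebraicGeometry.Deformation

open Literature.AlgebraicGeometry.Motives

variable {k : Type u} [Field k] {X : Over (Spec (CommRingCat.of k))}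
  [instΓ : ∀ W : X.left.Opens, Algebra k Γ(X.left, W)]
  (halg : ∀ (W : X.left.Opens) (s : k), algebraMap k Γ(X.left, W) s = (constToPresheaf X).app (op W) s)
  {A' A'' : Type u} [CommRing A'] [Algebra k A'] [CommRing A''] [Algebra k A''] (θ : A' →ₐ[k] A'')
  (hθ : Function.Surjective θ)

/-! ## §0 The kernel of `θ ⊗ 1`; base changes commute with `θ ⊗ 1` -/

omit instΓ in
include hθ in
/-- **`x ∈ (ker θ) · (A' ⊗_k B)` iff `(θ ⊗ 1) x = 0`** (right exactness of the tensor product: `A'' ⊗_k B = (A' ⊗_k B)/(ker θ)(A' ⊗_k B)`).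
[cite: AtiyahMacdonald1969, Prop. 2.18 and Ex. 2.2] -/
theorem mem_smul_top_iff_map_eq_zero {B : Type u} [CommRing B] [Algebra k B] (x : A' ⊗[k] B) :
    x ∈ RingHom.ker θ • (⊤ : Submodule A' (A' ⊗[k] B)) ↔
      Algebra.TensorProduct.map θ (AlgHom.id k B) x = 0 := by
  rw [Ideal.smul_top_eq_map, Submodule.restrictScalars_mem, ← RingHom.mem_ker,
    Algebra.TensorProduct.rTensor_ker _ hθ]
  have e : (RingHom.ker θ).map (algebraMap A' (A' ⊗[k] B)) =
      (RingHom.ker θ).map (Algebra.TensorProduct.includeLeft : A' →ₐ[k] A' ⊗[k] B) := by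
    apply le_antisymm
    · exact Ideal.map_le_iff_le_comap.mpr fun y hy => Ideal.mem_map_of_mem _ hy
    · exact Ideal.map_le_iff_le_comap.mpr fun y hy => Ideal.mem_map_of_mem _ hy
  rw [e, AlgHom.ker_coe]

omit instΓ in
/-- **Base changes commute with `θ ⊗ 1`**: `(θ ⊗ 1) (Φ z) = Φ₀ ((θ ⊗ 1) z)` for the characterised base-change maps over `A'` and
`A''`. [cite: Hartshorne2010, Thm. 10.2 (proof), p. 81] -/
theorem map_baseChangeMap [∀ W : X.left.Opens, Algebra k Γ(X.left, W)] {V W : X.left.Opens} (h : W ≤ V)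
    {Φ : A' ⊗[k] Γ(X.left, V) →ₐ[A'] A' ⊗[k] Γ(X.left, W)}
    (hΦ : ∀ a s, Φ (a ⊗ₜ s) = a ⊗ₜ X.left.presheaf.map (homOfLE h).op s)
    {Φ₀ : A'' ⊗[k] Γ(X.left, V) →ₐ[A''] A'' ⊗[k] Γ(X.left, W)}
    (hΦ₀ : ∀ a s, Φ₀ (a ⊗ₜ s) = a ⊗ₜ X.left.presheaf.map (homOfLE h).op s) (z : A' ⊗[k] Γ(X.left, V)) :
    Algebra.TensorProduct.map θ (AlgHom.id k Γ(X.left, W)) (Φ z) =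
      Φ₀ (Algebra.TensorProduct.map θ (AlgHom.id k Γ(X.left, V)) z) := by
  induction z using TensorProduct.induction_on with
  | zero => rw [map_zero, map_zero, map_zero, map_zero]
  | tmul a s => rw [hΦ, Algebra.TensorProduct.map_tmul, Algebra.TensorProduct.map_tmul, hΦ₀]; rfl
  | add x y hx hy => rw [map_add, map_add, hx, hy, map_add, map_add]

/-! ## §1 Descent of the restriction of `ψ⁻¹` along `θ ⊗ 1` -/

variable {ι : Type u} (U : ι → X.left.affineOpens) (b : (j l : ι) → Γ(X.left, (U j).1))
  (hb : ∀ j l, (U j).1 ⊓ (U l).1 = X.left.basicOpen (b j l))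

include halg in
/-- Constants restrict (naturality of `constToPresheaf`, for the variable `k`-structures fixed by `halg`).
[cite: Hartshorne2010, Thm. 10.2 (proof), p. 81] -/
private theorem algebraMap_eq_map_algebraMap'' {V W : X.left.Opens} (h : W ≤ V) (s : k) :
    algebraMap k Γ(X.left, W) s = X.left.presheaf.map (homOfLE h).op (algebraMap k Γ(X.left, V) s) := by
  rw [halg, halg, ← CommRingCat.comp_apply, ← (constToPresheaf X).naturality (homOfLE h).op]
  rfl

include halg hb in
/-- **Descent of the restriction**: for the restriction `τ` of `(ψ j l)⁻¹` to `A' ⊗_k Γ(U j ∩ U l ∩ U m)` and the restriction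
`τ₀` of `(φ j l)⁻¹` over `A''`, with `ψ`, `φ` compatible under `θ ⊗ 1`, one has `(θ ⊗ 1) ∘ τ = τ₀ ∘ (θ ⊗ 1)` (both are ring maps
out of the localisation `A' ⊗_k Γ(U j ∩ U l)_{b_{jm}}` agreeing on `A' ⊗_k Γ(U j ∩ U l)`).
[cite: Hartshorne2010, Thm. 10.2 (proof), p. 81] [cite: AtiyahMacdonald1969, Prop. 3.5] -/
theorem map_restrict_symm (j l m : ι)
    (ψ : A' ⊗[k] Γ(X.left, (U j).1 ⊓ (U l).1) ≃ₐ[A'] A' ⊗[k] Γ(X.left, (U j).1 ⊓ (U l).1))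
    (φ : A'' ⊗[k] Γ(X.left, (U j).1 ⊓ (U l).1) ≃ₐ[A''] A'' ⊗[k] Γ(X.left, (U j).1 ⊓ (U l).1))
    (hψσ : ∀ x, Algebra.TensorProduct.map θ (AlgHom.id k Γ(X.left, (U j).1 ⊓ (U l).1)) (ψ x) =
      φ (Algebra.TensorProduct.map θ (AlgHom.id k Γ(X.left, (U j).1 ⊓ (U l).1)) x))
    {Φ : A' ⊗[k] Γ(X.left, (U j).1 ⊓ (U l).1) →ₐ[A'] A' ⊗[k] Γ(X.left, (U j).1 ⊓ (U l).1 ⊓ (U m).1)}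
    (hΦ : ∀ a s, Φ (a ⊗ₜ s) = a ⊗ₜ X.left.presheaf.map (homOfLE inf_le_left).op s)
    {Φ₀ : A'' ⊗[k] Γ(X.left, (U j).1 ⊓ (U l).1) →ₐ[A''] A'' ⊗[k] Γ(X.left, (U j).1 ⊓ (U l).1 ⊓ (U m).1)}
    (hΦ₀ : ∀ a s, Φ₀ (a ⊗ₜ s) = a ⊗ₜ X.left.presheaf.map (homOfLE inf_le_left).op s)
    {τ : A' ⊗[k] Γ(X.left, (U j).1 ⊓ (U l).1 ⊓ (U m).1) ≃ₐ[A'] A' ⊗[k] Γ(X.left, (U j).1 ⊓ (U l).1 ⊓ (U m).1)}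
    (hτ : ∀ x, τ (Φ (ψ x)) = Φ x)
    {τ₀ : A'' ⊗[k] Γ(X.left, (U j).1 ⊓ (U l).1 ⊓ (U m).1) ≃ₐ[A''] A'' ⊗[k] Γ(X.left, (U j).1 ⊓ (U l).1 ⊓ (U m).1)}
    (hτ₀ : ∀ y, τ₀ (Φ₀ (φ y)) = Φ₀ y) (z : A' ⊗[k] Γ(X.left, (U j).1 ⊓ (U l).1 ⊓ (U m).1)) :
    Algebra.TensorProduct.map θ (AlgHom.id k Γ(X.left, (U j).1 ⊓ (U l).1 ⊓ (U m).1)) (τ z) =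
      τ₀ (Algebra.TensorProduct.map θ (AlgHom.id k Γ(X.left, (U j).1 ⊓ (U l).1 ⊓ (U m).1)) z) := by
  -- `Γ(U j ∩ U l ∩ U m)` is the localisation of `Γ(U j ∩ U l)` at `b_{jm}|`
  have hle : (U j).1 ⊓ (U l).1 ⊓ (U m).1 ≤ (U j).1 ⊓ (U l).1 := inf_le_left
  letI alg : Algebra Γ(X.left, (U j).1 ⊓ (U l).1) Γ(X.left, (U j).1 ⊓ (U l).1 ⊓ (U m).1) :=
    (X.left.presheaf.map (homOfLE hle).op).hom.toAlgebra
  haveI : IsScalarTower k Γ(X.left, (U j).1 ⊓ (U l).1) Γ(X.left, (U j).1 ⊓ (U l).1 ⊓ (U m).1) :=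
    IsScalarTower.of_algebraMap_eq fun s => algebraMap_eq_map_algebraMap'' halg hle s
  haveI : IsLocalization.Away (X.left.presheaf.map (homOfLE (inf_le_left : (U j).1 ⊓ (U l).1 ≤ (U j).1)).op (b j m))
      Γ(X.left, (U j).1 ⊓ (U l).1 ⊓ (U m).1) :=
    (isAffineOpen_inf₂ U b hb j l).isLocalization_of_eq_basicOpen _ (homOfLE hle)
      (inf_eq_basicOpen_map U b hb inf_le_left m)
  -- compare the two ring maps `(θ ⊗ 1) ∘ τ` and `τ₀ ∘ (θ ⊗ 1)` on `a ⊗ s|`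
  have key := SmoothAffineDeformation.ringHom_ext_baseChange_away (k := k) (B₀ := Γ(X.left, (U j).1 ⊓ (U l).1))
    (C₀ := Γ(X.left, (U j).1 ⊓ (U l).1 ⊓ (U m).1)) A'
    (X.left.presheaf.map (homOfLE (inf_le_left : (U j).1 ⊓ (U l).1 ≤ (U j).1)).op (b j m))
    (φ := (Algebra.TensorProduct.map θ (AlgHom.id k Γ(X.left, (U j).1 ⊓ (U l).1 ⊓ (U m).1))).toRingHom.comp
      τ.toAlgHom.toRingHom)
    (ψ := τ₀.toAlgHom.toRingHom.comp
      (Algebra.TensorProduct.map θ (AlgHom.id k Γ(X.left, (U j).1 ⊓ (U l).1 ⊓ (U m).1))).toRingHom) (fun a s => by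
      -- `a ⊗ s| = Φ (a ⊗ s) = Φ (ψ (ψ⁻¹ (a ⊗ s)))`
      have e1 : (a ⊗ₜ algebraMap Γ(X.left, (U j).1 ⊓ (U l).1) Γ(X.left, (U j).1 ⊓ (U l).1 ⊓ (U m).1) s :
          A' ⊗[k] Γ(X.left, (U j).1 ⊓ (U l).1 ⊓ (U m).1)) = Φ (ψ (ψ.symm (a ⊗ₜ s))) := by
        rw [AlgEquiv.apply_symm_apply, hΦ]
        rfl
      change Algebra.TensorProduct.map θ (AlgHom.id k _) (τ _) = τ₀ (Algebra.TensorProduct.map θ (AlgHom.id k _) _)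
      rw [e1, hτ, map_baseChangeMap θ hle hΦ hΦ₀, map_baseChangeMap θ hle hΦ hΦ₀, hψσ, hτ₀])
  exact RingHom.congr_fun key z

/-! ## §2 The twisted defect of the lifts is `≡ 1` modulo `ker θ` -/

include halg hb hθ in
/-- **LIFTS OF AN EXACT TWISTED COCYCLE GLUE MODULO `ker θ`.**  Let `G₀ j l ∈ A'' ⊗_k Γ(U j ∩ U l)` be UNITS satisfying the
exact twisted cocycle identity w.r.t. `φ` (for all characterised `Φ₀`, `τ₀`), `φ ≡ 1` modulo a nilpotent ideal `𝔫₀` of `A''`, and let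
`G j l ∈ A' ⊗_k Γ(U j ∩ U l)` with `(θ ⊗ 1) (G j l) = G₀ j l`, `ψ` compatible with `φ`.  Then the `G j l` satisfy the hypothesis
`hGcoc` of ★ `PairLiftTwistedCocycleObstruction.exists_pairObstructionCochain` with `J := ker θ`: whenever
`Φjm (G j m) · σ = Φjl (G j l) · τjl (Φlm (G l m))`, `σ - 1 ∈ (ker θ)·(A' ⊗ Γ)` (apply `θ ⊗ 1`: the base changes and the
restriction descend (§0, §1), the reduced identity is the exact one for `G₀`, and `Φ₀jm (G₀ j m)` is a unit).
[cite: Hartshorne2010, Thm. 6.4 (a) (proof, pp. 50–51)] [cite: AtiyahMacdonald1969, Prop. 2.18 and Ex. 2.2] -/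
theorem twistedDefect_sub_one_mem_of_map_eq
    (ψ : (j l : ι) → A' ⊗[k] Γ(X.left, (U j).1 ⊓ (U l).1) ≃ₐ[A'] A' ⊗[k] Γ(X.left, (U j).1 ⊓ (U l).1))
    (φ : (j l : ι) → A'' ⊗[k] Γ(X.left, (U j).1 ⊓ (U l).1) ≃ₐ[A''] A'' ⊗[k] Γ(X.left, (U j).1 ⊓ (U l).1))
    (𝔫₀ : Ideal A'') (h𝔫₀ : IsNilpotent 𝔫₀)
    (hφ : ∀ j l y, φ j l y - y ∈ 𝔫₀ • (⊤ : Submodule A'' (A'' ⊗[k] Γ(X.left, (U j).1 ⊓ (U l).1))))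
    (hψσ : ∀ j l x, Algebra.TensorProduct.map θ (AlgHom.id k Γ(X.left, (U j).1 ⊓ (U l).1)) (ψ j l x) =
      φ j l (Algebra.TensorProduct.map θ (AlgHom.id k Γ(X.left, (U j).1 ⊓ (U l).1)) x))
    (G₀ : (j l : ι) → A'' ⊗[k] Γ(X.left, (U j).1 ⊓ (U l).1)) (hG₀u : ∀ j l, IsUnit (G₀ j l))
    (hG₀coc : ∀ (j l m : ι)
      (Φjl : A'' ⊗[k] Γ(X.left, (U j).1 ⊓ (U l).1) →ₐ[A''] A'' ⊗[k] Γ(X.left, (U j).1 ⊓ (U l).1 ⊓ (U m).1))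
      (_ : ∀ a s, Φjl (a ⊗ₜ s) = a ⊗ₜ X.left.presheaf.map (homOfLE inf_le_left).op s)
      (Φlm : A'' ⊗[k] Γ(X.left, (U l).1 ⊓ (U m).1) →ₐ[A''] A'' ⊗[k] Γ(X.left, (U j).1 ⊓ (U l).1 ⊓ (U m).1))
      (_ : ∀ a s, Φlm (a ⊗ₜ s) = a ⊗ₜ X.left.presheaf.map
        (homOfLE (le_inf (inf_le_left.trans inf_le_right) inf_le_right)).op s)
      (Φjm : A'' ⊗[k] Γ(X.left, (U j).1 ⊓ (U m).1) →ₐ[A''] A'' ⊗[k] Γ(X.left, (U j).1 ⊓ (U l).1 ⊓ (U m).1))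
      (_ : ∀ a s, Φjm (a ⊗ₜ s) = a ⊗ₜ X.left.presheaf.map
        (homOfLE (le_inf (inf_le_left.trans inf_le_left) inf_le_right)).op s)
      (τjl : A'' ⊗[k] Γ(X.left, (U j).1 ⊓ (U l).1 ⊓ (U m).1) ≃ₐ[A'']
        A'' ⊗[k] Γ(X.left, (U j).1 ⊓ (U l).1 ⊓ (U m).1)),
      (∀ y, τjl (Φjl (φ j l y)) = Φjl y) → Φjm (G₀ j m) = Φjl (G₀ j l) * τjl (Φlm (G₀ l m)))
    (G : (j l : ι) → A' ⊗[k] Γ(X.left, (U j).1 ⊓ (U l).1))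
    (hGθ : ∀ j l, Algebra.TensorProduct.map θ (AlgHom.id k Γ(X.left, (U j).1 ⊓ (U l).1)) (G j l) = G₀ j l) :
    ∀ (j l m : ι)
      (Φjl : A' ⊗[k] Γ(X.left, (U j).1 ⊓ (U l).1) →ₐ[A'] A' ⊗[k] Γ(X.left, (U j).1 ⊓ (U l).1 ⊓ (U m).1))
      (_ : ∀ a s, Φjl (a ⊗ₜ s) = a ⊗ₜ X.left.presheaf.map (homOfLE inf_le_left).op s)
      (Φlm : A' ⊗[k] Γ(X.left, (U l).1 ⊓ (U m).1) →ₐ[A'] A' ⊗[k] Γ(X.left, (U j).1 ⊓ (U l).1 ⊓ (U m).1))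
      (_ : ∀ a s, Φlm (a ⊗ₜ s) = a ⊗ₜ X.left.presheaf.map
        (homOfLE (le_inf (inf_le_left.trans inf_le_right) inf_le_right)).op s)
      (Φjm : A' ⊗[k] Γ(X.left, (U j).1 ⊓ (U m).1) →ₐ[A'] A' ⊗[k] Γ(X.left, (U j).1 ⊓ (U l).1 ⊓ (U m).1))
      (_ : ∀ a s, Φjm (a ⊗ₜ s) = a ⊗ₜ X.left.presheaf.map
        (homOfLE (le_inf (inf_le_left.trans inf_le_left) inf_le_right)).op s)
      (τjl : A' ⊗[k] Γ(X.left, (U j).1 ⊓ (U l).1 ⊓ (U m).1) ≃ₐ[A'] A' ⊗[k] Γ(X.left, (U j).1 ⊓ (U l).1 ⊓ (U m).1)),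
      (∀ x, τjl (Φjl (ψ j l x)) = Φjl x) →
      ∀ σ, Φjm (G j m) * σ = Φjl (G j l) * τjl (Φlm (G l m)) →
        σ - 1 ∈ RingHom.ker θ • (⊤ : Submodule A' (A' ⊗[k] Γ(X.left, (U j).1 ⊓ (U l).1 ⊓ (U m).1))) := by
  intro j l m Φjl hΦjl Φlm hΦlm Φjm hΦjm τjl hτjl σ hσ
  -- the base changes over `A''` and the restriction `τ₀` of `(φ j l)⁻¹`
  have hle : (U j).1 ⊓ (U l).1 ⊓ (U m).1 ≤ (U j).1 ⊓ (U l).1 := inf_le_left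
  obtain ⟨Φjl₀, hΦjl₀⟩ := exists_baseChangeMap (A' := A'') halg ((U j).1 ⊓ (U l).1) ((U j).1 ⊓ (U l).1 ⊓ (U m).1) hle
  obtain ⟨Φlm₀, hΦlm₀⟩ := exists_baseChangeMap (A' := A'') halg ((U l).1 ⊓ (U m).1) ((U j).1 ⊓ (U l).1 ⊓ (U m).1)
    (le_inf (inf_le_left.trans inf_le_right) inf_le_right)
  obtain ⟨Φjm₀, hΦjm₀⟩ := exists_baseChangeMap (A' := A'') halg ((U j).1 ⊓ (U m).1) ((U j).1 ⊓ (U l).1 ⊓ (U m).1)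
    (le_inf (inf_le_left.trans inf_le_left) inf_le_right)
  obtain ⟨τ₀, hτ₀, -⟩ := exists_algEquiv_restrict_symm halg 𝔫₀ (isAffineOpen_inf₂ U b hb j l)
    (X.left.presheaf.map (homOfLE (inf_le_left : (U j).1 ⊓ (U l).1 ≤ (U j).1)).op (b j m))
    (inf_eq_basicOpen_map U b hb inf_le_left m) hle h𝔫₀ (φ j l) (hφ j l) (Φ := Φjl₀) hΦjl₀
  -- apply `θ ⊗ 1` to the defining equation of `σ`
  have hexact : Φjm₀ (G₀ j m) = Φjl₀ (G₀ j l) * τ₀ (Φlm₀ (G₀ l m)) :=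
    hG₀coc j l m Φjl₀ hΦjl₀ Φlm₀ hΦlm₀ Φjm₀ hΦjm₀ τ₀ hτ₀
  have hred := congrArg (Algebra.TensorProduct.map θ (AlgHom.id k Γ(X.left, (U j).1 ⊓ (U l).1 ⊓ (U m).1))) hσ
  rw [map_mul, map_mul, map_baseChangeMap θ _ hΦjm hΦjm₀, map_baseChangeMap θ _ hΦjl hΦjl₀, hGθ, hGθ,
    map_restrict_symm halg θ U b hb j l m (ψ j l) (φ j l) (hψσ j l) hΦjl hΦjl₀ hτjl hτ₀,
    map_baseChangeMap θ _ hΦlm hΦlm₀, hGθ, ← hexact] at hred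
  -- `Φjm₀ (G₀ j m)` is a unit: cancel
  have hunit : IsUnit (Φjm₀ (G₀ j m)) := (hG₀u j m).map Φjm₀
  have hone : Algebra.TensorProduct.map θ (AlgHom.id k Γ(X.left, (U j).1 ⊓ (U l).1 ⊓ (U m).1)) σ = 1 :=
    hunit.mul_left_cancel (hred.trans (mul_one _).symm)
  rw [mem_smul_top_iff_map_eq_zero θ hθ, map_sub, map_one, hone, sub_self]

/-! ## §3 Lifts exist -/

omit instΓ in
include hθ in
/-- **Lifts of the transition units exist**: `θ ⊗ 1` is surjective. [cite: AtiyahMacdonald1969, Prop. 2.18 and Ex. 2.2] -/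
theorem exists_map_eq [∀ W : X.left.Opens, Algebra k Γ(X.left, W)]
    (G₀ : (j l : ι) → A'' ⊗[k] Γ(X.left, (U j).1 ⊓ (U l).1)) :
    ∃ G : (j l : ι) → A' ⊗[k] Γ(X.left, (U j).1 ⊓ (U l).1),
      ∀ j l, Algebra.TensorProduct.map θ (AlgHom.id k Γ(X.left, (U j).1 ⊓ (U l).1)) (G j l) = G₀ j l := by
  have h : ∀ j l, ∃ G : A' ⊗[k] Γ(X.left, (U j).1 ⊓ (U l).1),
      Algebra.TensorProduct.map θ (AlgHom.id k Γ(X.left, (U j).1 ⊓ (U l).1)) G = G₀ j l := fun j l =>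
    Algebra.TensorProduct.map_surjective θ (AlgHom.id k _) hθ Function.surjective_id (G₀ j l)
  choose G hG using h
  exact ⟨G, hG⟩

end Literature.AlgebraicGeometry.Deformation

end
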